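import Summits.QuantumAdvantage.QuantumAdvantage.Theses.WhiteBoxWalk
import Literature.Computability.QuantumComplexity.SinkOfVerifiableLine

/-!
# Ideator 3 (gen 2) sketch — crux `WbwVerifiableLineNoSpeedup` (stmt-QuantumAdvantage-2239)

Structural TRANSFER for crux-plan (any surviving line): the whole crux is its behaviour at ONE
point per name length, `T = 2^(⌊m/2⌋ - 3)` ("the diagonal", where the walk branch and the
Grover branch bind simultaneously). Precisely, with `svlQ m T = Q_{1/3}(svlPromise m T, svlSinkBit m T)`:

* `Diagonal`         : `∃ κ > 0, ∀ m ≥ 6, κ · 2^(m/2) ≤ svlQ m (2^(m/2 - 3))`  (Nat division),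
* `PaddingMonotone`  : `svlQ m T' ≤ svlQ (m+1) T` for `1 ≤ T' ≤ T ≤ 2^m`   (Disproof.lean §7.2, verbatim),
* `DilationMonotone` : `svlQ m T ≤ svlQ m' T` for `m ≤ m'`                 (NEW here; same bit-copy
  re-indexing lemma as padding: rows `≥ 2^m` and the high bits of copied rows are constants, `V(x,i) = 0`
  for `x ≥ 2^m`; constants are copied from the promise-constant bits `V(0,0) = 1`, `V(1,0) = 0`),
* `OneLe`            : `1 ≤ svlQ m T` for `1 ≤ T`, `8T ≤ 2^m`                (Disproof.lean §3
  `one_le_svlQ`, to land as `Negative/Tightness.lean`),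

we have `smallT_of_diagonal : Diagonal → PaddingMonotone → DilationMonotone → OneLe → SvlAdversarySmallT`
(CHECKED below), and `SvlAdversarySmallT → PaddingMonotone → WbwVerifiableLineNoSpeedup` is the
disprover's checked `crux_of_smallT_of_padding` (Disproof.lean §7.3). Conversely
`SvlAdversarySmallT → Diagonal` with `κ := κ_A / 8` (since `8 · 2^(m/2-3) = 2^(m/2) ≤ 2^m` and
`min (2^(m/2-3)) √(2^m) = 2^(m/2-3)`), so nothing is lost: Diagonal ⇔ Target A modulo the two
re-indexing monotonicities. Every line may therefore aim its hard stubs at `Diagonal` alone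
(one asymptotic parameter; `8T ≤ 2^m`, `T ≤ √(2^m)/8`, `T² ≤ 2^m/64` all automatic).

CAVEAT (NOTES B3): at the diagonal a uniformly random FUNCTION background is NOT hard
(merge/rho-funnelling lands on the last `W = N^{2/5}` levels in `≈ 3 N^{2/5}` name queries), so
`Diagonal` must be proved on permutation / merge-free instances, as the adversary and
lazy-permutation cards do.
-/

noncomputable section

set_option linter.dupNamespace false

namespace Summit.QuantumAdvantage.QuantumAdvantage.Cruxes.WbwVerifiableLineNoSpeedup.Ideator3G2

open Literature.Computability.Cryptography Literature.Computability.QuantumComplexity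
open Summit.QuantumAdvantage.QuantumAdvantage.Theses.WhiteBoxWalk (WbwVerifiableLineNoSpeedup)

/-- The quantity bounded by the crux (same `abbrev` as `Disproof.svlQ` / `Negative.svlQ`). -/
abbrev svlQ (m T : ℕ) : ℕ := quantumQueryComplexityOn (1 / 3) (svlPromise m T) (svlSinkBit m T)

/-- Sanity: the crux is literally a statement about `svlQ` (`Iff.rfl`, as in `Negative.crux_iff`). -/
theorem crux_iff :
    WbwVerifiableLineNoSpeedup ↔
      ∃ c : ℝ, 0 < c ∧ ∀ m T : ℕ, 2 ≤ m → 1 ≤ T → T + 1 ≤ 2 ^ (m - 1) →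
        c * min ((T : ℝ) + 1) (Real.sqrt (2 ^ m)) / m ≤ (svlQ m T : ℝ) :=
  Iff.rfl

/-- The diagonal step count `T_m := 2^(⌊m/2⌋ - 3)`. -/
def diagT (m : ℕ) : ℕ := 2 ^ (m / 2 - 3)

/-- **Diagonal form of the crux**: `Ω(2^{m/2})` bit queries at `T = 2^(⌊m/2⌋-3)`. -/
def Diagonal : Prop :=
  ∃ κ : ℝ, 0 < κ ∧ ∀ m : ℕ, 6 ≤ m → κ * (2 : ℝ) ^ (m / 2) ≤ (svlQ m (diagT m) : ℝ)

/-- Padding monotonicity (Disproof.lean §7.2 `PaddingMonotone`, verbatim over `svlQ`). -/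
def PaddingMonotone : Prop :=
  ∀ m T T' : ℕ, 1 ≤ T' → T' ≤ T → T ≤ 2 ^ m → svlQ m T' ≤ svlQ (m + 1) T

/-- Dilation monotonicity: more names, same line length, never easier (bit-copy embedding). -/
def DilationMonotone : Prop :=
  ∀ m m' T : ℕ, m ≤ m' → svlQ m T ≤ svlQ m' T

/-- `Q ≥ 1` in Target A's regime (Disproof.lean §3 `one_le_svlQ`: the sink bit is non-constant on
the promise as soon as `T ≥ 1` and `T + 2 ≤ 2^m`). -/
def OneLe : Prop := ∀ m T : ℕ, 1 ≤ T → 8 * T ≤ 2 ^ m → 1 ≤ svlQ m T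

/-- Target A of Disproof.lean §7 (verbatim): `κ · min(T, √(2^m)) ≤ Q` whenever `8T ≤ 2^m`. -/
def SvlAdversarySmallT : Prop :=
  ∃ κ : ℝ, 0 < κ ∧ ∀ m T : ℕ, 1 ≤ T → 8 * T ≤ 2 ^ m →
    κ * min (T : ℝ) (Real.sqrt (2 ^ m)) ≤ (svlQ m T : ℝ)

/-- `√(2^m) ≤ 2 · 2^(⌊(m-1)/2⌋)` for `m ≥ 1`. -/
theorem sqrt_two_pow_le (m : ℕ) (hm : 1 ≤ m) :
    Real.sqrt ((2 : ℝ) ^ m) ≤ 2 * (2 : ℝ) ^ ((m - 1) / 2) := by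
  have hnat : m ≤ 2 + 2 * ((m - 1) / 2) := by omega
  have hpow : (2 : ℝ) ^ m ≤ (2 * (2 : ℝ) ^ ((m - 1) / 2)) ^ 2 := by
    have : (2 * (2 : ℝ) ^ ((m - 1) / 2)) ^ 2 = (2 : ℝ) ^ (2 + 2 * ((m - 1) / 2)) := by
      rw [mul_pow, ← pow_mul, pow_add, mul_comm ((m - 1) / 2) 2]
    rw [this]
    exact pow_le_pow_right₀ (by norm_num) hnat
  calc Real.sqrt ((2 : ℝ) ^ m) ≤ Real.sqrt ((2 * (2 : ℝ) ^ ((m - 1) / 2)) ^ 2) :=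
        Real.sqrt_le_sqrt hpow
    _ = 2 * (2 : ℝ) ^ ((m - 1) / 2) := Real.sqrt_sq (by positivity)

/-- **CHECKED REDUCTION.** The diagonal statement, the two re-indexing monotonicities and `Q ≥ 1`
give Target A with `κ' = min (κ/2) (1/12)`. -/
theorem smallT_of_diagonal (hD : Diagonal) (hP : PaddingMonotone) (hDil : DilationMonotone)
    (h1 : OneLe) : SvlAdversarySmallT := by
  obtain ⟨κ, hκ, hD⟩ := hD
  refine ⟨min (κ / 2) (1 / 12), by positivity, fun m T hT h8 => ?_⟩
  set c : ℝ := min (κ / 2) (1 / 12) with hc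
  have hc2 : c ≤ κ / 2 := min_le_left _ _
  have hc12 : c ≤ 1 / 12 := min_le_right _ _
  have hcpos : 0 < c := by positivity
  have hQ1 : (1 : ℝ) ≤ (svlQ m T : ℝ) := by exact_mod_cast h1 m T hT h8
  have hTR : (1 : ℝ) ≤ T := by exact_mod_cast hT
  have hsqrt_pos : 0 < Real.sqrt ((2 : ℝ) ^ m) := Real.sqrt_pos.2 (by positivity)
  by_cases hm8 : m < 8
  · -- small name lengths: min ≤ √(2^7) ≤ 12, c ≤ 1/12, Q ≥ 1
    have hsq : Real.sqrt ((2 : ℝ) ^ m) ≤ 12 := by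
      have h27 : (2 : ℝ) ^ m ≤ 2 ^ 7 := pow_le_pow_right₀ (by norm_num) (by omega)
      calc Real.sqrt ((2 : ℝ) ^ m) ≤ Real.sqrt (2 ^ 7) := Real.sqrt_le_sqrt h27
        _ ≤ Real.sqrt (12 ^ 2) := Real.sqrt_le_sqrt (by norm_num)
        _ = 12 := Real.sqrt_sq (by norm_num)
    calc c * min (T : ℝ) (Real.sqrt (2 ^ m)) ≤ (1 / 12) * 12 := by
          apply mul_le_mul hc12 ((min_le_right _ _).trans hsq) (by positivity) (by norm_num)
      _ = 1 := by norm_num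
      _ ≤ (svlQ m T : ℝ) := hQ1
  · push Not at hm8
    -- s := ⌊log₂ T⌋, 2^s ≤ T < 2^(s+1)
    set s : ℕ := Nat.log 2 T with hs
    have hT0 : T ≠ 0 := by omega
    have hsle : 2 ^ s ≤ T := by
      rw [hs]; exact Nat.pow_log_le_self 2 hT0
    have hslt : T < 2 ^ (s + 1) := by
      rw [hs]; exact Nat.lt_pow_succ_log_self (by norm_num) T
    set m₀ : ℕ := 2 * s + 6 with hm₀
    have hdiag₀ : diagT m₀ = 2 ^ s := by
      simp only [diagT, hm₀]
      congr 1
      omega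
    by_cases hcase : m₀ + 1 ≤ m
    · -- walk branch: Diagonal at m₀, pad to (m₀+1, T), dilate to m
      have h6 : 6 ≤ m₀ := by omega
      have hDm := hD m₀ h6
      rw [hdiag₀] at hDm
      have hm₀half : m₀ / 2 = s + 3 := by omega
      rw [hm₀half] at hDm
      -- padding: svlQ m₀ (2^s) ≤ svlQ (m₀+1) T
      have hTle : T ≤ 2 ^ m₀ := by
        have : 2 ^ (s + 1) ≤ 2 ^ m₀ := Nat.pow_le_pow_right (by norm_num) (by omega)
        omega
      have hpad := hP m₀ T (2 ^ s) Nat.one_le_two_pow hsle hTle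
      have hdil := hDil (m₀ + 1) m T hcase
      have hchain : κ * (2 : ℝ) ^ (s + 3) ≤ (svlQ m T : ℝ) :=
        hDm.trans (by exact_mod_cast hpad.trans hdil)
      -- κ 2^(s+3) = 8κ 2^s ≥ 4κ T ≥ c·T ≥ c·min(T, √N)
      have hTlt : (T : ℝ) < 2 * (2 : ℝ) ^ s := by
        have : (T : ℝ) < ((2 ^ (s + 1) : ℕ) : ℝ) := by exact_mod_cast hslt
        simpa [pow_succ, mul_comm] using this
      calc c * min (T : ℝ) (Real.sqrt (2 ^ m)) ≤ c * T := by
            gcongr; exact min_le_left _ _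
        _ ≤ (κ / 2) * (2 * (2 : ℝ) ^ s) := by
            apply mul_le_mul hc2 hTlt.le (by positivity) (by positivity)
        _ ≤ κ * (2 : ℝ) ^ (s + 3) := by
            rw [pow_succ, pow_succ, pow_succ]
            nlinarith [pow_pos (by norm_num : (0 : ℝ) < 2) s]
        _ ≤ (svlQ m T : ℝ) := hchain
    · -- Grover branch: m ≤ m₀ = 2s + 6, so √(2^m) ≤ 8·2^s ≤ 8T; Diagonal at m-1, pad to (m, T)
      push Not at hcase
      have hmle : m ≤ 2 * s + 6 := by omega
      obtain ⟨m', rfl⟩ : ∃ m', m = m' + 1 := ⟨m - 1, by omega⟩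
      have h6 : 6 ≤ m' := by omega
      have hDm := hD m' h6
      -- diagT m' ≤ T: m' ≤ 2s+5 ⇒ m'/2 - 3 ≤ s - 1 + ... ; precisely m'/2 ≤ s + 2, so m'/2 - 3 ≤ s
      have hexp : m' / 2 - 3 ≤ s := by omega
      have hdiag_le : diagT m' ≤ T := by
        calc diagT m' = 2 ^ (m' / 2 - 3) := rfl
          _ ≤ 2 ^ s := Nat.pow_le_pow_right (by norm_num) hexp
          _ ≤ T := hsle
      have hdiag_pos : 1 ≤ diagT m' := Nat.one_le_two_pow
      have hTle : T ≤ 2 ^ m' := by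
        have : 8 * T ≤ 2 ^ (m' + 1) := h8
        rw [pow_succ] at this
        omega
      have hpad := hP m' T (diagT m') hdiag_pos hdiag_le hTle
      have hchain : κ * (2 : ℝ) ^ (m' / 2) ≤ (svlQ (m' + 1) T : ℝ) :=
        hDm.trans (by exact_mod_cast hpad)
      -- √(2^(m'+1)) ≤ 2 · 2^(m'/2)
      have hsq : Real.sqrt ((2 : ℝ) ^ (m' + 1)) ≤ 2 * (2 : ℝ) ^ (m' / 2) := by
        have := sqrt_two_pow_le (m' + 1) (by omega)
        simpa using this
      calc c * min (T : ℝ) (Real.sqrt (2 ^ (m' + 1))) ≤ c * Real.sqrt (2 ^ (m' + 1)) := by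
            gcongr; exact min_le_right _ _
        _ ≤ (κ / 2) * (2 * (2 : ℝ) ^ (m' / 2)) := by
            apply mul_le_mul hc2 hsq (by positivity) (by positivity)
        _ = κ * (2 : ℝ) ^ (m' / 2) := by ring
        _ ≤ (svlQ (m' + 1) T : ℝ) := hchain

/-- The converse direction (Target A ⇒ Diagonal), so the transfer loses nothing. -/
theorem diagonal_of_smallT (hA : SvlAdversarySmallT) : Diagonal := by
  obtain ⟨κ, hκ, hA⟩ := hA
  refine ⟨κ / 8, by positivity, fun m hm => ?_⟩
  have hT : 1 ≤ diagT m := Nat.one_le_two_pow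
  have hexp : m / 2 - 3 + 3 = m / 2 := by omega
  have h8 : 8 * diagT m ≤ 2 ^ m := by
    calc 8 * diagT m = 2 ^ (m / 2 - 3 + 3) := by
          rw [pow_add]; simp [diagT]; ring
      _ ≤ 2 ^ m := Nat.pow_le_pow_right (by norm_num) (by omega)
  have hb := hA m (diagT m) hT h8
  -- min (diagT m) √(2^m) = diagT m since (diagT m)² · 64 ≤ 2^m
  have hTR : ((diagT m : ℕ) : ℝ) = (2 : ℝ) ^ (m / 2 - 3) := by simp [diagT]
  have hle : ((diagT m : ℕ) : ℝ) ≤ Real.sqrt ((2 : ℝ) ^ m) := by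
    rw [hTR, show (2 : ℝ) ^ (m / 2 - 3) = Real.sqrt (((2 : ℝ) ^ (m / 2 - 3)) ^ 2) from
      (Real.sqrt_sq (by positivity)).symm]
    apply Real.sqrt_le_sqrt
    rw [← pow_mul]
    exact pow_le_pow_right₀ (by norm_num) (by omega)
  rw [min_eq_left hle, hTR] at hb
  have h2 : (2 : ℝ) ^ (m / 2) = 8 * (2 : ℝ) ^ (m / 2 - 3) := by
    conv_lhs => rw [← hexp, pow_add]
    norm_num; ring
  calc κ / 8 * (2 : ℝ) ^ (m / 2) = κ * (2 : ℝ) ^ (m / 2 - 3) := by rw [h2]; ring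
    _ ≤ (svlQ m (diagT m) : ℝ) := hb

end Summit.QuantumAdvantage.QuantumAdvantage.Cruxes.WbwVerifiableLineNoSpeedup.Ideator3G2
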